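import Mathlib
import Summits.CriticalPhenomena.CardyFormulaZ2.Theorems.CardyMagicRigidityNestingRigidityTreeRigidityReconstruction
import HarnessLib

/-!
# Stub `stub_treeRigidity`: TYPED reconstruction up to `d_CN = 0` from per-type surround counts

Crux `Summit.CriticalPhenomena.CardyFormulaZ2.Theses.CardyMagicRigidity.NestingRigidity`
(stmt-CriticalPhenomena-4835), line `positive-cone-weight-doubling`, registered stub `stub_treeRigidity`.
Continuation of `…TreeRigidityReconstruction` (p128704: on an interior-rigid support class, equal one- and
two-disc surround counts of two `Regular` configurations force UNTYPED `cnEDist = 0`, and typed closeness only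
given a type-matching hypothesis).  The audit of seat c4-0 recommends running the type step (3) ON THE
LATTICE (exact alternation, exact/`O(δ)` swap symmetry, everything measurable) and feeding TYPED count
statistics to the reconstruction.  This file supplies the matching deterministic core:

* `regular_typeRestrict` — the single-type part `⟨fun j ↦ if j = i then c.F i else ∅⟩` of a `Regular`
  configuration is `Regular` (every clause restricts to sub-families);
* `isClose_of_typedCounts_eq` (registered anchor) — two `Regular` configurations carried by an interior-rigid
  class `𝒞` (`{W u ≠ 0} = {W v ≠ 0} → d(u, v) = 0` on `𝒞`) whose PER-TYPE one-disc and separated two-disc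
  surround counts at rational data agree in every window are `ε`-close for every `ε ≥ 0`, hence at
  `cnEDist = 0` (`cnEDist_eq_zero_of_typedCounts_eq`): apply the untyped theorem type by type.
-/

noncomputable section

open MeasureTheory Set Filter Metric
open scoped Real Topology BigOperators ENNReal

namespace Summit.CriticalPhenomena.CardyFormulaZ2.Cruxes.NestingRigidity.PositiveConeWeightDoubling

open Literature.Probability.RandomPlanarGeometry
open Summit.CriticalPhenomena.CardyFormulaZ2.Cruxes.NestingRigidity.RingCloudTomography

/-- The loops of the single-type part of a configuration are its loops of that type. -/
theorem loops_typeRestrict (c : LoopConfig ℂ) (i : Fin 2) :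
    (⟨fun j ↦ if j = i then c.F i else ∅⟩ : LoopConfig ℂ).loops = c.F i := by
  fin_cases i <;> simp [LoopConfig.loops]

/-- **The single-type part of a regular configuration is regular** (local finiteness, degree one, the
boundary property, laminarity and separation all restrict to sub-families). -/
theorem regular_typeRestrict {c : LoopConfig ℂ} (hc : Regular c) (i : Fin 2) :
    Regular (⟨fun j ↦ if j = i then c.F i else ∅⟩ : LoopConfig ℂ) := by
  have hsub : (⟨fun j ↦ if j = i then c.F i else ∅⟩ : LoopConfig ℂ).loops ⊆ c.loops := by
    rw [loops_typeRestrict]; exact LoopConfig.subset_loops c i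
  refine ⟨hc.locallyFinite.mono fun j ↦ ?_, fun u hu ↦ hc.degreeOne u (hsub hu),
    fun u hu ↦ hc.boundary u (hsub hu), fun u hu v hv ↦ hc.laminar u (hsub hu) v (hsub hv),
    fun u hu v hv ↦ hc.separating u (hsub hu) v (hsub hv)⟩
  change (if j = i then c.F i else ∅) ⊆ c.F j
  split_ifs with h
  · rw [h]
  · exact empty_subset _

/-- **Typed closeness from per-type surround counts, on an interior-rigid class (registered anchor).**  Let
`𝒞` be interior-rigid and carry two `Regular` configurations `c`, `c'`.  If for each type `i` the one-disc
and the separated two-disc surround counts of the type-`i` loops (pattern counts of the single-type parts at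
`S = univ`, rational centres and radii, every window) agree, then `d_CN(c, c') ≤ ε` for every `ε ≥ 0`. -/
theorem isClose_of_typedCounts_eq : ∀ {𝒞 : Set (UnbasedLoop ℂ)},
    (∀ u ∈ 𝒞, ∀ v ∈ 𝒞, {z | u.wind z ≠ 0} = {z | v.wind z ≠ 0} → u.udist v = 0) →
    ∀ {c c' : LoopConfig ℂ}, Regular c → Regular c' → c.loops ⊆ 𝒞 → c'.loops ⊆ 𝒞 →
    (∀ (i : Fin 2) (R : ℝ) (q : ℚ × ℚ) (s : ℚ), 0 < s →
      patternCount (⟨fun j ↦ if j = i then c.F i else ∅⟩ : LoopConfig ℂ) ![(⟨q.1, q.2⟩ : ℂ)] ![(s : ℝ)] R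
          Finset.univ =
        patternCount (⟨fun j ↦ if j = i then c'.F i else ∅⟩ : LoopConfig ℂ) ![(⟨q.1, q.2⟩ : ℂ)] ![(s : ℝ)] R
          Finset.univ) →
    (∀ (i : Fin 2) (R : ℝ) (q q' : ℚ × ℚ) (s s' : ℚ), 0 < s → 0 < s' →
      (s : ℝ) + s' < ‖(⟨q.1, q.2⟩ : ℂ) - ⟨q'.1, q'.2⟩‖ →
      patternCount (⟨fun j ↦ if j = i then c.F i else ∅⟩ : LoopConfig ℂ) ![(⟨q.1, q.2⟩ : ℂ), ⟨q'.1, q'.2⟩]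
          ![(s : ℝ), s'] R Finset.univ =
        patternCount (⟨fun j ↦ if j = i then c'.F i else ∅⟩ : LoopConfig ℂ)
          ![(⟨q.1, q.2⟩ : ℂ), ⟨q'.1, q'.2⟩] ![(s : ℝ), s'] R Finset.univ) →
    ∀ ε : ℝ, 0 ≤ ε → LoopConfig.IsClose ε c c' := by
  intro 𝒞 h𝒞 c c' hc hc' hsub hsub' h₁ h₂ ε hε i
  -- the interior-preserving, `udist`-null bijection of the type-`i` parts
  have hci := regular_typeRestrict hc i
  have hc'i := regular_typeRestrict hc' i
  have hsubi : (⟨fun j ↦ if j = i then c.F i else ∅⟩ : LoopConfig ℂ).loops ⊆ 𝒞 := by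
    rw [loops_typeRestrict]; exact (LoopConfig.subset_loops c i).trans hsub
  have hsub'i : (⟨fun j ↦ if j = i then c'.F i else ∅⟩ : LoopConfig ℂ).loops ⊆ 𝒞 := by
    rw [loops_typeRestrict]; exact (LoopConfig.subset_loops c' i).trans hsub'
  obtain ⟨e, he⟩ := exists_interiorEquiv_udist_eq_zero_of_counts_eq h𝒞 hci hc'i hsubi hsub'i (h₁ i) (h₂ i)
  have hl : (⟨fun j ↦ if j = i then c.F i else ∅⟩ : LoopConfig ℂ).loops = c.F i := loops_typeRestrict c i
  have hl' : (⟨fun j ↦ if j = i then c'.F i else ∅⟩ : LoopConfig ℂ).loops = c'.F i := loops_typeRestrict c' i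
  refine ⟨fun u hu _ ↦ ?_, fun u' hu' _ ↦ ?_⟩
  · have hu' : u ∈ (⟨fun j ↦ if j = i then c.F i else ∅⟩ : LoopConfig ℂ).loops := by rw [hl]; exact hu
    refine ⟨e ⟨u, hu'⟩, ?_, (he ⟨u, hu'⟩).2.le.trans hε⟩
    exact hl'.subset (e ⟨u, hu'⟩).2
  · have hu'' : u' ∈ (⟨fun j ↦ if j = i then c'.F i else ∅⟩ : LoopConfig ℂ).loops := by
      rw [hl']; exact hu'
    have h1 := he (e.symm ⟨u', hu''⟩)
    rw [Equiv.apply_symm_apply] at h1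
    refine ⟨e.symm ⟨u', hu''⟩, hl.subset (e.symm ⟨u', hu''⟩).2, ?_⟩
    rw [UnbasedLoop.udist_comm]
    exact h1.2.le.trans hε

/-- **Typed reconstruction up to `d_CN = 0`**: under the hypotheses of `isClose_of_typedCounts_eq`,
`cnEDist c c' = 0`. -/
theorem cnEDist_eq_zero_of_typedCounts_eq {𝒞 : Set (UnbasedLoop ℂ)}
    (h𝒞 : ∀ u ∈ 𝒞, ∀ v ∈ 𝒞, {z | u.wind z ≠ 0} = {z | v.wind z ≠ 0} → u.udist v = 0)
    {c c' : LoopConfig ℂ} (hc : Regular c) (hc' : Regular c') (hsub : c.loops ⊆ 𝒞) (hsub' : c'.loops ⊆ 𝒞)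
    (h₁ : ∀ (i : Fin 2) (R : ℝ) (q : ℚ × ℚ) (s : ℚ), 0 < s →
      patternCount (⟨fun j ↦ if j = i then c.F i else ∅⟩ : LoopConfig ℂ) ![(⟨q.1, q.2⟩ : ℂ)] ![(s : ℝ)] R
          Finset.univ =
        patternCount (⟨fun j ↦ if j = i then c'.F i else ∅⟩ : LoopConfig ℂ) ![(⟨q.1, q.2⟩ : ℂ)] ![(s : ℝ)] R
          Finset.univ)
    (h₂ : ∀ (i : Fin 2) (R : ℝ) (q q' : ℚ × ℚ) (s s' : ℚ), 0 < s → 0 < s' →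
      (s : ℝ) + s' < ‖(⟨q.1, q.2⟩ : ℂ) - ⟨q'.1, q'.2⟩‖ →
      patternCount (⟨fun j ↦ if j = i then c.F i else ∅⟩ : LoopConfig ℂ) ![(⟨q.1, q.2⟩ : ℂ), ⟨q'.1, q'.2⟩]
          ![(s : ℝ), s'] R Finset.univ =
        patternCount (⟨fun j ↦ if j = i then c'.F i else ∅⟩ : LoopConfig ℂ)
          ![(⟨q.1, q.2⟩ : ℂ), ⟨q'.1, q'.2⟩] ![(s : ℝ), s'] R Finset.univ) :
    LoopConfig.cnEDist c c' = 0 :=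
  cnEDist_eq_zero_of_forall_isClose fun ε hε ↦
    isClose_of_typedCounts_eq h𝒞 hc hc' hsub hsub' h₁ h₂ ε hε.le

end Summit.CriticalPhenomena.CardyFormulaZ2.Cruxes.NestingRigidity.PositiveConeWeightDoubling

end
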